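import Summits.BirchSwinnertonDyer.Rank1Residual.GaloisImage.SelmerClassInertia
import Summits.BirchSwinnertonDyer.BirchSwinnertonDyer.Theorems.SmallImageMuTransferMuTransferX9TorsionUnramifiedOutside
import Literature.NumberTheory.GaloisRepresentations.CoinducedDiscreteGaloisModule
import Literature.NumberTheory.GaloisRepresentations.ContinuousShapiroLiftCores
import Literature.NumberTheory.EllipticCurves.ZpExtensionUnramifiedProofs
import Literature.NumberTheory.EllipticCurves.HeegnerModuleIndex
import Literature.NumberTheory.DiophantineGeometry.LocalReduction
import HarnessLib

/-!
# Route `ThetaPartnerAtTwo` (TP2), crux K2R0P♭ `SignedMainConjectureCMTwoRankZeroOfPubOfFlat` (stmt-BirchSwinnertonDyer-26471;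
# derived node K2r0P 24945), line `rankzero` v20, stub `stub_poitouTateDeepTwo` = (S_PT), hypothesis (E) `hE` of the stub-closer
# `SignedLowerOffTwo.PTDeep.poitouTateDeepTwo_of_levelwise_of_badInertia` — brick (E1): **SHAPIRO TRANSPORT OF ADMISSIBILITY**
# (a layer class whose Shapiro lift is locally unramified at `w` dies on every `Γ_n ∩ I_𝔓`, `𝔓 ∣ w`)

HONEST FRAMING (cell `pub/bsd-wall`, W-ALL row 1; extra width seat `bsd-wall-tp2-p2-w4` g0, brick (E1) as assigned on the bus by
`tp2-p2-w3` g3, 2026-08-28T11:42Z; `--supports` only). THEOREMS ONLY (no definition, no named fact, no instance, no `sorry`); closes no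
item; BSD is NOT proved by any of this.

## What is proved

Let `K` be a number field, `ρ : Γ_K → Aut(M)` a discrete Galois module, `N ≤ Γ_K` an open subgroup of finite index (a layer
`Γ_n = κ.layerSubgroup n` of a `ℤ_p`-extension), `Maps(Γ_K ⧸ N, M)` the coinduced module in BOTH of its tree guises — the topological
representation `coindFin ρ.toTopRep N` of the Shapiro files and the discrete Galois module `ρ.coind N hN` of
`CoinducedDiscreteGaloisModule.lean` (the same object: `DiscreteGaloisModule.toTopRep_coind` is `rfl`) — and
`Sh_N : H¹(N, M) → H¹(Γ_K, Maps(Γ_K ⧸ N, M))` the tree's Shapiro lift `shapiroLift` (any coset representatives `s`, `s(1·N) = 1`).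

* §1 `isUnramifiedAt_coind` (module level): if `ρ` is unramified at the finite place `w` and `N` contains every inertia group
  `I_𝔓`, `𝔓 ∣ w`, then **`Maps(Γ_K ⧸ N, M)` is unramified at `w`** (`GaloisRep.IsUnramifiedAt w (ρ.coind N hN)`): `σ ∈ I_𝔓` fixes every
  coset `hN` (`h⁻¹ σ h ∈ I_{h⁻¹𝔓} ≤ N`) and acts trivially on the values.
* §2 `resLe_inertia_eq_zero_of_localization_shapiroLift_mem` (class level): if moreover the localisation at `w` of `Sh_N c` lies in the
  unramified subgroup `H¹_ur(K_w, Maps(Γ_K ⧸ N, M))` (`unramifiedSubgroup (GaloisRep.toLocal w _) 1`, the local condition of a Selmer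
  structure «unramified at `w`»), then **`res_{N ∩ I_𝔓} c = 0` for every `𝔓 ∣ w`** — the ADMISSIBILITY clause of the lead's sets `R n k`
  (`…PTDeepAdmissible.lean`) / of hypothesis `hE` of `…PTDeepClose.lean`, VERBATIM in the subgroup currency
  `resLe ρ.toTopRep (inf_le_left : N ⊓ 𝔓.inertia Γ_K ≤ N) 1 c = 0`. Proof: a cocycle `f` of `c` has `Sh f` vanishing on `I_𝔓`
  (`SelmerFinite.apply_eq_zero_of_mem_inertia_of_localization_mem`, the tree's local–global inertia bridge, applied to the unramified module
  of §1), and `f = evalOne (Sh f)` (`evalOne_shapiroCocycle`), so `f` vanishes on `N ∩ I_𝔓`.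
* §3 the layer instances: `inertia_le_layerSubgroup` (`I_𝔓 ≤ Γ_n` for `𝔓 ∣ w ∤ p`: a `ℤ_p`-extension is unramified away from `p`,
  `ZpExtension.inertia_le_kerSubgroup_holds`), `isUnramifiedAt_coind_torsionGaloisModule_layerSubgroup` (`Maps(Γ_K ⧸ Γ_n, E[p^k])` is
  unramified at every good `w ∤ p`), and the `hE`-shaped corollaries `resLe_inertia_layer_eq_zero_of_localization_shapiroLift_mem` /
  `admissible_of_forall_localization_shapiroLift_mem` (over `ℚ`: for `c : A.torsionH1Over ((p:ℤ)^k) (κ.layerSubgroup n)`, if `Sh c` is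
  locally unramified at every `w ∉ S_A = {w ∋ p} ∪ A.badPlaces` then `c` is admissible: `∀ w ∉ S_A, ∀ 𝔓 ∣ w, resLe … 1 c = 0`).

Consumer: the (E2) socket of `tp2-p2-w3` (Milne I 4.10 (b) on `Maps(Γ_ℚ ⧸ Γ_n, A[2^k])` through `SelmerComplement` + w2's transfer B5 + this
file ⟹ `hE`).

References: [NeukirchSchmidtWingberg2008] I §6 Prop. (1.6.4) (Shapiro's lemma, explicit inverse `evalOne`); [SerreLocalFields1979] VII §5–§6;
[MilneADT2006] I §4 (unramified classes, before Lemma 4.8); [Washington1997] Prop. 13.2; [SilvermanAEC2009] Prop. VII.4.1 (a).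
-/

set_option autoImplicit false
-- the Theorems namespace of this sub repeats the summit name by design (D-0017 nested layout)
set_option linter.dupNamespace false

noncomputable section

open scoped Classical NumberField Pointwise

universe u

namespace Summit.BirchSwinnertonDyer.BirchSwinnertonDyer.Theorems

namespace SignedLowerOffTwo.PTDeep

open CategoryTheory Field NumberField IsDedekindDomain
  Literature.NumberTheory.GaloisRepresentations Literature.NumberTheory.GaloisRepresentations.DiscreteGaloisModule
  Literature.NumberTheory.EllipticCurves
  Summit.BirchSwinnertonDyer.Rank1Residual.GaloisImage.SelmerFinite

/-! ## §1 The coinduced module is unramified at `w` as soon as `M` is and `N` contains the inertia groups above `w` -/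

section Module

variable {K : Type u} [Field K] [NumberField K] {M : Type u} [AddCommGroup M] [TopologicalSpace M] [DiscreteTopology M]
  (ρ : DiscreteGaloisModule K M) (N : Subgroup (absoluteGaloisGroup K)) [Fintype (absoluteGaloisGroup K ⧸ N)]
  (hN : IsOpen (N : Set (absoluteGaloisGroup K)))

omit [NumberField K] [Fintype (absoluteGaloisGroup K ⧸ N)] in
/-- An element of an inertia group above `w` fixes every coset `hN` when `N` contains all the inertia groups above `w`
(`h⁻¹ σ h ∈ I_{h⁻¹𝔓} ≤ N`). [folklore] -/
theorem inv_smul_quotient_eq_of_mem_inertia {w : HeightOneSpectrum (𝓞 K)}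
    (hIN : ∀ 𝔓 ∈ w.primesAbove, 𝔓.inertia (absoluteGaloisGroup K) ≤ N)
    {𝔓 : Ideal (absIntegers (𝓞 K) K)} (h𝔓 : 𝔓 ∈ w.primesAbove) {σ : absoluteGaloisGroup K}
    (hσ : σ ∈ 𝔓.inertia (absoluteGaloisGroup K)) (y : absoluteGaloisGroup K ⧸ N) : σ⁻¹ • y = y := by
  induction y using QuotientGroup.induction_on with
  | H h =>
    rw [MulAction.Quotient.smul_coe, QuotientGroup.eq, smul_eq_mul]
    have e : (σ⁻¹ * h)⁻¹ * h = h⁻¹ * σ * h⁻¹⁻¹ := by group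
    rw [e]
    exact hIN (h⁻¹ • 𝔓) (smul_mem_primesAbove h𝔓 h⁻¹) ((Ideal.conj_mem_inertia_smul_iff 𝔓 h⁻¹ σ).mpr hσ)

omit [NumberField K] in
/-- **§1 `Maps(Γ_K ⧸ N, M)` is unramified at `w`** if `M` is unramified at `w` and `N ⊇ I_𝔓` for every prime `𝔓 ∣ w` of `\bar ℤ_K`
(the action is `(σ ⋆ φ)(y) = σ • φ(σ⁻¹ • y)`; `σ ∈ I_𝔓` fixes the cosets and the values). [cite: NeukirchSchmidtWingberg2008, I §6 Prop. (1.6.4)]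
[cite: SilvermanAEC2009, Prop. VII.4.1 (a)] -/
theorem isUnramifiedAt_coind {w : HeightOneSpectrum (𝓞 K)} (hρ : GaloisRep.IsUnramifiedAt w ρ)
    (hIN : ∀ 𝔓 ∈ w.primesAbove, 𝔓.inertia (absoluteGaloisGroup K) ≤ N) :
    GaloisRep.IsUnramifiedAt w (ρ.coind N hN) := by
  intro 𝔓 h𝔓 σ hσ
  refine LinearMap.ext fun φ ↦ funext fun y ↦ ?_
  rw [DiscreteGaloisModule.coind_apply_apply, inv_smul_quotient_eq_of_mem_inertia N hIN h𝔓 hσ y, hρ 𝔓 h𝔓 σ hσ,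
    Module.End.one_apply, Module.End.one_apply]

end Module

/-! ## §2 Class level: Shapiro transport of the unramified local condition to the layer -/

section Transport

variable {K : Type u} [Field K] [NumberField K] {M : Type u} [AddCommGroup M] [TopologicalSpace M] [DiscreteTopology M]
  (ρ : DiscreteGaloisModule K M) (N : Subgroup (absoluteGaloisGroup K)) [Fintype (absoluteGaloisGroup K ⧸ N)]
  (hN : IsOpen (N : Set (absoluteGaloisGroup K))) {s : absoluteGaloisGroup K ⧸ N → absoluteGaloisGroup K}
  (hs : ∀ x : absoluteGaloisGroup K ⧸ N, (s x : absoluteGaloisGroup K ⧸ N) = x)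
  (hs1 : s ((1 : absoluteGaloisGroup K) : absoluteGaloisGroup K ⧸ N) = 1)

omit [NumberField K] [Fintype (absoluteGaloisGroup K ⧸ N)] in
include hs1 in
/-- **A cocycle of `N` whose Shapiro cocycle vanishes at `σ ∈ N` vanishes at `σ`** (`f = evalOne (Sh f)`).
[cite: NeukirchSchmidtWingberg2008, I §6 Prop. (1.6.4)] -/
theorem apply_eq_zero_of_shapiroCocycle_apply_eq_zero (f : contOneCocycles (subgroupRep ρ.toTopRep N))
    {σ : absoluteGaloisGroup K} (hσN : σ ∈ N) (h0 : (shapiroCocycle ρ.toTopRep N hN hs f).1 σ = 0) :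
    f.1 ⟨σ, hσN⟩ = 0 := by
  have hev := evalOne_shapiroCocycle ρ.toTopRep N hN hs hs1 f
  calc f.1 ⟨σ, hσN⟩ = (evalOne ρ.toTopRep N (shapiroCocycle ρ.toTopRep N hN hs f)).1 ⟨σ, hσN⟩ := by rw [hev]
    _ = (shapiroCocycle ρ.toTopRep N hN hs f).1 σ ((1 : absoluteGaloisGroup K) : absoluteGaloisGroup K ⧸ N) :=
        evalOne_apply ρ.toTopRep N _ ⟨σ, hσN⟩
    _ = 0 := by rw [h0]; rfl

/-- **§2 SHAPIRO TRANSPORT OF ADMISSIBILITY.** Let `Maps(Γ_K ⧸ N, M)` be unramified at `w` (§1) and let `c ∈ H¹(N, M)` be a layer class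
whose Shapiro lift `Sh_N c ∈ H¹(Γ_K, Maps(Γ_K ⧸ N, M))` localises at `w` into the unramified subgroup `H¹_ur(K_w, ·)`. Then the restriction
of `c` to `N ∩ I_𝔓` vanishes for every prime `𝔓 ∣ w` of `\bar ℤ_K`. [cite: NeukirchSchmidtWingberg2008, I §6 Prop. (1.6.4)]
[cite: MilneADT2006, Ch. I §4 (unramified classes)] -/
theorem resLe_inertia_eq_zero_of_localization_shapiroLift_mem {w : HeightOneSpectrum (𝓞 K)}
    (hunr : GaloisRep.IsUnramifiedAt w (ρ.coind N hN)) (c : H1 ρ N)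
    (hc : galoisCohomology.localization (ρ.coind N hN) (Sum.inr w) 1 (shapiroLift ρ.toTopRep N hN hs hs1 c) ∈
      unramifiedSubgroup (GaloisRep.toLocal w (ρ.coind N hN)) 1)
    {𝔓 : Ideal (absIntegers (𝓞 K) K)} (h𝔓 : 𝔓 ∈ w.primesAbove) :
    resLe ρ.toTopRep (inf_le_left : N ⊓ 𝔓.inertia (absoluteGaloisGroup K) ≤ N) 1 c = 0 := by
  obtain ⟨f, rfl⟩ := oneCocycleClass_surjective _ c
  rw [shapiroLift_oneCocycleClass] at hc
  -- the Shapiro cocycle vanishes on `I_𝔓`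
  have hF := apply_eq_zero_of_mem_inertia_of_localization_mem (ρ.coind N hN) hunr (shapiroCocycle ρ.toTopRep N hN hs f) hc
  -- hence `f` vanishes on `N ∩ I_𝔓`
  rw [resLe_oneCocycleClass, oneCocycleClass_eq_zero_iff]
  refine ⟨0, fun g ↦ ?_⟩
  rw [map_zero, sub_zero, contOneCocycles.pullback_apply, TopRep.hom_ofHom]
  change f.1 (subgroupInclusion (inf_le_left : N ⊓ 𝔓.inertia (absoluteGaloisGroup K) ≤ N) g) = 0
  have hg : subgroupInclusion (inf_le_left : N ⊓ 𝔓.inertia (absoluteGaloisGroup K) ≤ N) g =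
      ⟨(g : absoluteGaloisGroup K), g.2.1⟩ := Subtype.ext (subgroupInclusion_apply_coe _ g)
  rw [hg]
  exact apply_eq_zero_of_shapiroCocycle_apply_eq_zero ρ N hN hs hs1 f g.2.1 (hF 𝔓 h𝔓 _ g.2.2)

end Transport

/-! ## §3 The layers of a `ℤ_p`-extension, and the admissibility clause of `hE` -/

section Layers

variable {K : Type u} [Field K] [NumberField K] {p : ℕ} [Fact p.Prime] (κ : ZpExtension K p)

/-- **`I_𝔓 ≤ Γ_n` for `𝔓 ∣ w ∤ p`**: every layer of a `ℤ_p`-extension contains the inertia groups away from `p`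
(`ZpExtension.inertia_le_kerSubgroup_holds` + `ker κ ≤ Γ_n`). [cite: Washington1997, Prop. 13.2] -/
theorem inertia_le_layerSubgroup (n : ℕ) {w : HeightOneSpectrum (𝓞 K)} (hpw : (p : 𝓞 K) ∉ w.asIdeal) :
    ∀ 𝔓 ∈ w.primesAbove, 𝔓.inertia (absoluteGaloisGroup K) ≤ κ.layerSubgroup n := fun _ h𝔓 _ hσ ↦
  κ.kerSubgroup_le_layerSubgroup n (ZpExtension.inertia_le_kerSubgroup_holds K p κ hpw h𝔓 hσ)

variable (W : WeierstrassCurve K) [W.IsElliptic]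

/-- **`Maps(Γ_K ⧸ Γ_n, E[p^k])` is unramified at every good `w ∤ p`** (§1 + Silverman VII.4.1 (a) + `I_𝔓 ≤ Γ_n`).
[cite: SilvermanAEC2009, Prop. VII.4.1 (a)] [cite: Washington1997, Prop. 13.2] -/
theorem isUnramifiedAt_coind_torsionGaloisModule_layerSubgroup (n k : ℕ) [Fintype (absoluteGaloisGroup K ⧸ κ.layerSubgroup n)]
    {w : HeightOneSpectrum (𝓞 K)} (hpw : (p : 𝓞 K) ∉ w.asIdeal) (hgood : W.HasGoodReductionAt w) :
    GaloisRep.IsUnramifiedAt w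
      ((W.torsionGaloisModule ((p : ℤ) ^ k)).coind (κ.layerSubgroup n) (κ.isOpen_layerSubgroup n)) := by
  refine isUnramifiedAt_coind _ _ _ ?_ (inertia_le_layerSubgroup κ n hpw)
  refine Summit.BirchSwinnertonDyer.BirchSwinnertonDyer.Rank1Residual.TorsionUnramified.isUnramifiedAt_torsionGaloisModule_of_hasGoodReductionAt
    W hgood ?_
  rw [Int.cast_pow, Int.cast_natCast]
  exact fun h ↦ hpw (w.isPrime.mem_of_pow_mem k h)

/-- **The layer form of §2 for `E[p^k]` at a good place `w ∤ p`**: if the Shapiro lift of `c ∈ H¹(Γ_n, E[p^k])` localises at `w` into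
`H¹_ur(K_w, Maps(Γ_K ⧸ Γ_n, E[p^k]))`, then `res_{Γ_n ∩ I_𝔓} c = 0` for every `𝔓 ∣ w`.
[cite: NeukirchSchmidtWingberg2008, I §6 Prop. (1.6.4)] [cite: MilneADT2006, Ch. I §4] -/
theorem resLe_inertia_layer_eq_zero_of_localization_shapiroLift_mem (n k : ℕ)
    [Fintype (absoluteGaloisGroup K ⧸ κ.layerSubgroup n)]
    {s : absoluteGaloisGroup K ⧸ κ.layerSubgroup n → absoluteGaloisGroup K}
    (hs : ∀ x : absoluteGaloisGroup K ⧸ κ.layerSubgroup n, (s x : absoluteGaloisGroup K ⧸ κ.layerSubgroup n) = x)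
    (hs1 : s ((1 : absoluteGaloisGroup K) : absoluteGaloisGroup K ⧸ κ.layerSubgroup n) = 1)
    {w : HeightOneSpectrum (𝓞 K)} (hpw : (p : 𝓞 K) ∉ w.asIdeal) (hgood : W.HasGoodReductionAt w)
    (c : W.torsionH1Over ((p : ℤ) ^ k) (κ.layerSubgroup n))
    (hc : galoisCohomology.localization
        ((W.torsionGaloisModule ((p : ℤ) ^ k)).coind (κ.layerSubgroup n) (κ.isOpen_layerSubgroup n)) (Sum.inr w) 1
        (shapiroLift (W.torsionGaloisModule ((p : ℤ) ^ k)).toTopRep (κ.layerSubgroup n) (κ.isOpen_layerSubgroup n) hs hs1 c) ∈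
      unramifiedSubgroup (GaloisRep.toLocal w
        ((W.torsionGaloisModule ((p : ℤ) ^ k)).coind (κ.layerSubgroup n) (κ.isOpen_layerSubgroup n))) 1) :
    ∀ 𝔓 ∈ w.primesAbove,
      resLe (W.torsionGaloisModule ((p : ℤ) ^ k)).toTopRep
        (inf_le_left : κ.layerSubgroup n ⊓ 𝔓.inertia (absoluteGaloisGroup K) ≤ κ.layerSubgroup n) 1 c = 0 :=
  fun _ h𝔓 ↦ resLe_inertia_eq_zero_of_localization_shapiroLift_mem _ _ _ hs hs1
    (isUnramifiedAt_coind_torsionGaloisModule_layerSubgroup κ W n k hpw hgood) c hc h𝔓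

end Layers

/-! ## §4 Over `ℚ`: the admissibility clause of `hE` (`S_A = {w ∋ p} ∪ A.badPlaces`) -/

section Rat

variable (A : WeierstrassCurve ℚ) [A.IsElliptic] {p : ℕ} [Fact p.Prime] (κ : ZpExtension ℚ p)

omit [A.IsElliptic] [Fact p.Prime] in
/-- A place outside `S_A = {w ∋ p} ∪ A.badPlaces` is prime to `p` and of good reduction. [folklore] -/
theorem not_mem_and_hasGoodReductionAt_of_not_mem_union {w : HeightOneSpectrum (𝓞 ℚ)}
    (hw : w ∉ ({u : HeightOneSpectrum (𝓞 ℚ) | ((p : ℕ) : 𝓞 ℚ) ∈ u.asIdeal} ∪ A.badPlaces (𝓞 ℚ))) :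
    ((p : ℕ) : 𝓞 ℚ) ∉ w.asIdeal ∧ A.HasGoodReductionAt w := by
  rw [Set.mem_union, not_or] at hw
  exact ⟨hw.1, not_not.mp hw.2⟩

/-- **(E1) in the currency of `hE`.** For `c ∈ H¹(Γ_n, A[p^k])` (`A.torsionH1Over ((p:ℤ)^k) (κ.layerSubgroup n)`): if for every place
`w ∉ S_A = {w ∋ p} ∪ A.badPlaces` the localisation at `w` of the Shapiro lift `Sh c ∈ H¹(Γ_ℚ, Maps(Γ_ℚ ⧸ Γ_n, A[p^k]))` lies in the unramified
subgroup, then `c` is ADMISSIBLE: `∀ w ∉ S_A, ∀ 𝔓 ∣ w, resLe … (Γ_n ⊓ I_𝔓 ≤ Γ_n) 1 c = 0` — the first conjunct demanded of `c` by hypothesis `hE`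
of `poitouTateDeepTwo_of_levelwise_of_badInertia`. [cite: NeukirchSchmidtWingberg2008, I §6 Prop. (1.6.4)] [cite: MilneADT2006, Ch. I §4] -/
theorem admissible_of_forall_localization_shapiroLift_mem (n k : ℕ) [Fintype (absoluteGaloisGroup ℚ ⧸ κ.layerSubgroup n)]
    {s : absoluteGaloisGroup ℚ ⧸ κ.layerSubgroup n → absoluteGaloisGroup ℚ}
    (hs : ∀ x : absoluteGaloisGroup ℚ ⧸ κ.layerSubgroup n, (s x : absoluteGaloisGroup ℚ ⧸ κ.layerSubgroup n) = x)
    (hs1 : s ((1 : absoluteGaloisGroup ℚ) : absoluteGaloisGroup ℚ ⧸ κ.layerSubgroup n) = 1)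
    (c : A.torsionH1Over ((p : ℤ) ^ k) (κ.layerSubgroup n))
    (hc : ∀ w : HeightOneSpectrum (𝓞 ℚ),
      w ∉ ({u : HeightOneSpectrum (𝓞 ℚ) | ((p : ℕ) : 𝓞 ℚ) ∈ u.asIdeal} ∪ A.badPlaces (𝓞 ℚ)) →
      galoisCohomology.localization
          ((A.torsionGaloisModule ((p : ℤ) ^ k)).coind (κ.layerSubgroup n) (κ.isOpen_layerSubgroup n)) (Sum.inr w) 1
          (shapiroLift (A.torsionGaloisModule ((p : ℤ) ^ k)).toTopRep (κ.layerSubgroup n) (κ.isOpen_layerSubgroup n) hs hs1 c) ∈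
        unramifiedSubgroup (GaloisRep.toLocal w
          ((A.torsionGaloisModule ((p : ℤ) ^ k)).coind (κ.layerSubgroup n) (κ.isOpen_layerSubgroup n))) 1) :
    ∀ w : HeightOneSpectrum (𝓞 ℚ), w ∉ ({u : HeightOneSpectrum (𝓞 ℚ) | ((p : ℕ) : 𝓞 ℚ) ∈ u.asIdeal} ∪ A.badPlaces (𝓞 ℚ)) →
      ∀ 𝔓 ∈ w.primesAbove,
        resLe (A.torsionGaloisModule ((p : ℤ) ^ k)).toTopRep
          (inf_le_left : κ.layerSubgroup n ⊓ 𝔓.inertia (absoluteGaloisGroup ℚ) ≤ κ.layerSubgroup n) 1 c = 0 := by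
  intro w hw
  obtain ⟨hpw, hgood⟩ := not_mem_and_hasGoodReductionAt_of_not_mem_union A hw
  exact resLe_inertia_layer_eq_zero_of_localization_shapiroLift_mem κ A n k hs hs1 hpw hgood c (hc w hw)

end Rat

end SignedLowerOffTwo.PTDeep

end Summit.BirchSwinnertonDyer.BirchSwinnertonDyer.Theorems

end
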